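import Literature.Computability.Complexity.CodeFPBudgets
import Mathlib.Analysis.SpecialFunctions.Pow.NthRootLemmas
import Mathlib.Analysis.SpecialFunctions.Pow.Real
import HarnessLib

/-!
# The integer cube root on codes (`CodeFP`), and the scaled cube root `⌊2ᵏ ∛n⌋`

Toolkit (`Computability/Complexity`, the typed brick algebra `CodeFP` of `CodeFP.lean` /
`CodeFPArith.lean` / `CodeFPBudgets.lean`); companion of `NatSqrtFP.lean` (`Nat.sqrt` on binary
numerals) for CUBE roots, stated for Mathlib's `Nat.nthRoot 3` (`= ⌊n^{1/3}⌋`,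
`Mathlib/Data/Nat/NthRoot`, characterised by `Nat.nthRoot_eq_of_le_of_lt`), so that no new
definition is introduced:

* `natCbrt : CodeFP natE natE (Nat.nthRoot 3)` — by BISECTION on `[lo, hi)` with the invariant
  `lo³ ≤ n < hi³` from `(0, n + 1)`, as a fold (`CodeFP.foldl`) over a unary budget of `|bin n|`
  rounds (each round at least halves `hi - lo - 1`, `cbrtBisect_foldl`, so the budget exhausts it,
  `cbrtBisect_eq_nthRoot`); the state never exceeds `n + 1`, which is the polynomial size bound the
  fold brick asks for;
* `natCbrtScaled : CodeFP (pairE natE unE) natE (fun p => Nat.nthRoot 3 (p.1 * 8 ^ p.2))` — the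
  cube root to `k` binary places, `⌊2ᵏ ∛n⌋ = ⌊∛(n 8ᵏ)⌋` with `k` in unary;
* `abs_rpow_third_sub_nthRoot_div_le` — its accuracy in `ℝ`: `|n^{1/3} - ⌊∛(n 8ᵏ)⌋ / 2ᵏ| ≤ 2⁻ᵏ`.

This is the evaluator of real cube roots needed for fixed-point logarithms of elements
`u + v∛m + w∛m²` of a pure cubic field (the cubic analogue of `sqrtShiftApprox` in
`Cryptography/FixedPointLogarithmFP.lean`). Bisection rather than Newton's iteration (by which
Mathlib DEFINES `Nat.nthRoot`) because its loop invariant and its round count are one line each.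

## References

* S. Arora, B. Barak, *Computational Complexity: A Modern Approach*, CUP 2009, §1.3 (polynomial
  time is closed under composition and polynomially bounded loops). [AroraBarak2009]
* D. E. Knuth, *The Art of Computer Programming*, Vol. 2, 3rd ed. (1998), §4.3.1 (classical
  multiple-precision arithmetic; bisection for roots is schoolbook and fully proved here). [KnuthTAOCP2]
-/

namespace Literature.Computability.Complexity

namespace CodeFP

open _root_.Computability Polynomial Brick

/-! ### Bisection towards `⌊∛n⌋`: the loop invariant -/

section Bisect

variable {n : ℕ} {step : ℕ × ℕ → ℕ × ℕ}

/-- **One bisection round keeps `lo³ ≤ n < hi³`, `lo < hi`, does not increase `hi`, and at least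
halves the excess width `hi - lo - 1`.** Phrased for an arbitrary model `step` of the round
(`step (lo, hi) = (mid, hi)` or `(lo, mid)` according as `mid³ ≤ n`, `mid = ⌊(lo + hi)/2⌋`). [folklore] -/
theorem cbrtBisect_step
    (hstep : ∀ lo hi, step (lo, hi) =
      if ((lo + hi) / 2) ^ 3 ≤ n then ((lo + hi) / 2, hi) else (lo, (lo + hi) / 2))
    {lo hi : ℕ} (h1 : lo ^ 3 ≤ n) (h2 : n < hi ^ 3) (h3 : lo < hi) :
    (step (lo, hi)).1 ^ 3 ≤ n ∧ n < (step (lo, hi)).2 ^ 3 ∧ (step (lo, hi)).1 < (step (lo, hi)).2 ∧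
      2 * ((step (lo, hi)).2 - (step (lo, hi)).1 - 1) ≤ hi - lo - 1 ∧ (step (lo, hi)).2 ≤ hi := by
  rw [hstep]
  by_cases h : ((lo + hi) / 2) ^ 3 ≤ n
  · rw [if_pos h]
    refine ⟨h, h2, by omega, by omega, le_rfl⟩
  · rw [if_neg h]
    have hlt : lo < (lo + hi) / 2 := by
      by_contra hc
      have he : (lo + hi) / 2 = lo := by omega
      rw [he] at h
      exact h h1
    refine ⟨h1, not_le.mp h, hlt, by omega, by omega⟩

/-- **The bisection fold**: after the rounds of the budget list `l` the invariant still holds,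
`hi` has not increased, and the excess width has been divided by `2^{|l|}`. [folklore] -/
theorem cbrtBisect_foldl
    (hstep : ∀ lo hi, step (lo, hi) =
      if ((lo + hi) / 2) ^ 3 ≤ n then ((lo + hi) / 2, hi) else (lo, (lo + hi) / 2))
    (l : List Unit) : ∀ {lo hi : ℕ}, lo ^ 3 ≤ n → n < hi ^ 3 → lo < hi →
      (l.foldl (fun st _ => step st) (lo, hi)).1 ^ 3 ≤ n ∧
      n < (l.foldl (fun st _ => step st) (lo, hi)).2 ^ 3 ∧
      (l.foldl (fun st _ => step st) (lo, hi)).1 < (l.foldl (fun st _ => step st) (lo, hi)).2 ∧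
      ((l.foldl (fun st _ => step st) (lo, hi)).2 - (l.foldl (fun st _ => step st) (lo, hi)).1 - 1) *
          2 ^ l.length ≤ hi - lo - 1 ∧
      (l.foldl (fun st _ => step st) (lo, hi)).2 ≤ hi := by
  induction l with
  | nil => intro lo hi h1 h2 h3; simpa using ⟨h1, h2, h3⟩
  | cons u l ih =>
    intro lo hi h1 h2 h3
    obtain ⟨s1, s2, s3, s4, s5⟩ := cbrtBisect_step hstep h1 h2 h3
    rw [List.foldl_cons, show step (lo, hi) = ((step (lo, hi)).1, (step (lo, hi)).2) from rfl]
    obtain ⟨r1, r2, r3, r4, r5⟩ := ih s1 s2 s3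
    refine ⟨r1, r2, r3, ?_, r5.trans s5⟩
    rw [List.length_cons, pow_succ, ← mul_assoc]
    calc _ ≤ ((step (lo, hi)).2 - (step (lo, hi)).1 - 1) * 2 := Nat.mul_le_mul_right 2 r4
      _ ≤ hi - lo - 1 := by omega

/-- **Bisection computes `⌊∛n⌋`**: from `(0, n + 1)`, after at least `|bin n|` rounds the bracket
is `[r, r + 1)` with `r³ ≤ n < (r + 1)³`, i.e. `r = Nat.nthRoot 3 n`. [folklore] -/
theorem cbrtBisect_eq_nthRoot
    (hstep : ∀ lo hi, step (lo, hi) =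
      if ((lo + hi) / 2) ^ 3 ≤ n then ((lo + hi) / 2, hi) else (lo, (lo + hi) / 2))
    (l : List Unit) (hl : Nat.size n ≤ l.length) :
    (l.foldl (fun st _ => step st) (0, n + 1)).1 = Nat.nthRoot 3 n := by
  obtain ⟨r1, r2, r3, r4, -⟩ := cbrtBisect_foldl hstep l (lo := 0) (hi := n + 1)
    (by simp) ((Nat.lt_succ_self n).trans_le (Nat.le_self_pow three_ne_zero _)) (Nat.succ_pos n)
  set r := l.foldl (fun st _ => step st) (0, n + 1) with hr
  have hpow : n < 2 ^ l.length := (Nat.lt_size_self n).trans_le (Nat.pow_le_pow_right two_pos hl)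
  have hd : r.2 - r.1 - 1 = 0 := by
    by_contra hne
    have h1 : 1 * 2 ^ l.length ≤ (r.2 - r.1 - 1) * 2 ^ l.length :=
      Nat.mul_le_mul_right _ (Nat.one_le_iff_ne_zero.mpr hne)
    omega
  have heq : r.2 = r.1 + 1 := by omega
  rw [heq] at r2
  exact (Nat.nthRoot_eq_of_le_of_lt r1 r2).symm

end Bisect

/-! ### The cube root on codes -/

/-- **`Nat.nthRoot 3` (the integer cube root `⌊∛n⌋` of a binary numeral) is computed on codes in
polynomial time**, by bisection over a unary budget of `|bin n|` rounds.
[cite: AroraBarak2009, §1.3 (polynomially bounded loops)] -/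
theorem natCbrt : CodeFP natE natE (Nat.nthRoot 3) := by
  obtain ⟨step, hstepEq⟩ : ∃ step : ℕ → ℕ × ℕ → ℕ × ℕ, ∀ n st, step n st =
      if ((st.1 + st.2) / 2) ^ 3 ≤ n then ((st.1 + st.2) / 2, st.2) else (st.1, (st.1 + st.2) / 2) :=
    ⟨_, fun _ _ => rfl⟩
  have hstep' : ∀ n lo hi, step n (lo, hi) =
      if ((lo + hi) / 2) ^ 3 ≤ n then ((lo + hi) / 2, hi) else (lo, (lo + hi) / 2) :=
    fun n lo hi => hstepEq n (lo, hi)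
  let stE : ℕ × ℕ → List Bool := pairE natE natE
  -- the round on codes: `t = (n, (), (lo, hi))`
  have hP : CodeFP (pairE natE (pairE unitE stE)) natE (fun t => t.2.2.1) := (snd _ _).snd'.fst'
  have hR : CodeFP (pairE natE (pairE unitE stE)) natE (fun t => t.2.2.2) := (snd _ _).snd'.snd'
  have hmid : CodeFP (pairE natE (pairE unitE stE)) natE (fun t => (t.2.2.1 + t.2.2.2) / 2) :=
    natDiv.comp ((natAdd.comp (hP.pair hR)).pair (const _ 2))
  have hcube : CodeFP (pairE natE (pairE unitE stE)) natE (fun t => ((t.2.2.1 + t.2.2.2) / 2) ^ 3) :=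
    (natMul.comp (hmid.pair (natMul.comp (hmid.pair hmid)))).congr fun t => by ring
  have htest : CodeFP (pairE natE (pairE unitE stE)) bitE
      (fun t => decide (((t.2.2.1 + t.2.2.2) / 2) ^ 3 ≤ t.1)) :=
    natLe.comp (hcube.pair (fst _ _))
  have hstep : CodeFP (pairE natE (pairE unitE stE)) stE (fun t => step t.1 t.2.2) :=
    (htest.ite (hmid.pair hR) (hP.pair hmid)).congr fun t => by
      rw [hstepEq]; simp only [decide_eq_true_eq]
  -- the fold over the budget, from `(0, n + 1)`; the state stays below `n + 1`
  have hinit : CodeFP natE stE (fun n => ((0 : ℕ), n + 1)) :=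
    ((const natE (0 : ℕ)).pair (natAdd.comp ((CodeFP.id natE).pair (const natE (1 : ℕ))))).congr
      fun n => rfl
  have hfold := foldl (σ := ℕ) (α := Unit) (β := ℕ × ℕ) (eσ := natE) (eα := unitE) (eβ := stE)
    (step := fun n (_ : Unit) st => step n st) (init := fun n => ((0 : ℕ), n + 1)) hstep hinit
    (2 * X + 6) (fun n l₁ l₂ => by
      obtain ⟨-, -, r3, -, r5⟩ := cbrtBisect_foldl (hstep' n) l₁ (lo := 0) (hi := n + 1)
        (by simp) ((Nat.lt_succ_self n).trans_le (Nat.le_self_pow three_ne_zero _)) (Nat.succ_pos n)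
      set r := l₁.foldl (fun st (_ : Unit) => step n st) (0, n + 1) with hr
      have h1 : (natE r.1).length ≤ (natE n).length := by
        rw [length_natE, length_natE]; exact size_mono (by omega)
      have h2 : (natE r.2).length ≤ (natE n).length + 2 := by
        rw [length_natE, length_natE]
        refine (size_mono r5).trans ((size_add_le n 1).trans ?_)
        have : Nat.size 1 = 1 := rfl
        rw [this]; omega
      simp only [stE, pairE_apply, length_boolPair, eval_add, eval_mul, eval_X, eval_ofNat]
      change 2 * (natE r.1).length + 2 + (natE r.2).length ≤ _
      omega)
  -- the budget `1^{|n|₂}` as a raw list of units, and the assembly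
  have hsize : CodeFP natE unE Nat.size := (strLength.comp strOfNat).congr fun n => length_natE n
  have hbud : CodeFP natE (rawE unitE) (fun n => List.replicate (Nat.size n) ()) :=
    replicateUnit.comp hsize
  refine ((hfold.comp ((CodeFP.id natE).pair hbud)).fst').congr fun n => ?_
  change (List.foldl (fun st (_ : Unit) => step n st) (0, n + 1) (List.replicate (Nat.size n) ())).1 = _
  exact cbrtBisect_eq_nthRoot (hstep' n) _ (by rw [List.length_replicate])

/-- **The cube root to `k` binary places**: `(bin n, 1ᵏ) ↦ bin ⌊∛(n · 8ᵏ)⌋ = bin ⌊2ᵏ ∛n⌋`.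
[cite: AroraBarak2009, §1.3] -/
theorem natCbrtScaled : CodeFP (pairE natE unE) natE (fun p => Nat.nthRoot 3 (p.1 * 8 ^ p.2)) :=
  (natCbrt.comp (natMul.comp ((fst _ _).pair (natPow.comp ((const _ 8).pair (snd _ _)))))).congr
    fun _ => rfl

/-! ### Accuracy of the scaled cube root in `ℝ` -/

/-- `⌊∛N⌋ ≤ N^{1/3} < ⌊∛N⌋ + 1` in `ℝ`. [folklore] -/
theorem nthRoot_three_le_rpow_and_lt (N : ℕ) :
    (Nat.nthRoot 3 N : ℝ) ≤ (N : ℝ) ^ (1 / 3 : ℝ) ∧ (N : ℝ) ^ (1 / 3 : ℝ) < Nat.nthRoot 3 N + 1 := by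
  have h3 : (3 : ℕ) ≠ 0 := by norm_num
  have hlo : ((Nat.nthRoot 3 N : ℕ) : ℝ) ^ (3 : ℕ) ≤ N := by
    exact_mod_cast Nat.pow_nthRoot_le (Or.inl h3)
  have hhi : (N : ℝ) < ((Nat.nthRoot 3 N + 1 : ℕ) : ℝ) ^ (3 : ℕ) := by
    exact_mod_cast Nat.lt_pow_nthRoot_add_one h3 N
  have hN : (0 : ℝ) ≤ N := Nat.cast_nonneg N
  constructor
  · have h := Real.rpow_le_rpow (by positivity) hlo (by norm_num : (0 : ℝ) ≤ 1 / 3)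
    rwa [← Real.rpow_natCast, ← Real.rpow_mul (Nat.cast_nonneg _),
      show ((3 : ℕ) : ℝ) * (1 / 3) = 1 by norm_num, Real.rpow_one] at h
  · have h := Real.rpow_lt_rpow hN hhi (by norm_num : (0 : ℝ) < 1 / 3)
    rw [← Real.rpow_natCast, ← Real.rpow_mul (Nat.cast_nonneg _),
      show ((3 : ℕ) : ℝ) * (1 / 3) = 1 by norm_num, Real.rpow_one] at h
    exact_mod_cast h

/-- **`|n^{1/3} - ⌊∛(n 8ᵏ)⌋ / 2ᵏ| ≤ 2⁻ᵏ`**: the scaled integer cube root is the real cube root to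
`k` binary places. [folklore] -/
theorem abs_rpow_third_sub_nthRoot_div_le (n k : ℕ) :
    |(n : ℝ) ^ (1 / 3 : ℝ) - (Nat.nthRoot 3 (n * 8 ^ k) : ℝ) / 2 ^ k| ≤ 1 / 2 ^ k := by
  obtain ⟨hlo, hhi⟩ := nthRoot_three_le_rpow_and_lt (n * 8 ^ k)
  have hpos : (0 : ℝ) < 2 ^ k := by positivity
  have hscale : (((n * 8 ^ k : ℕ)) : ℝ) ^ (1 / 3 : ℝ) = (n : ℝ) ^ (1 / 3 : ℝ) * 2 ^ k := by
    have h8 : ((8 : ℝ) ^ k) = ((2 : ℝ) ^ k) ^ (3 : ℕ) := by rw [← pow_mul, mul_comm, pow_mul]; norm_num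
    push_cast
    rw [Real.mul_rpow (Nat.cast_nonneg n) (by positivity), h8, ← Real.rpow_natCast,
      ← Real.rpow_mul (by positivity), show ((3 : ℕ) : ℝ) * (1 / 3) = 1 by norm_num, Real.rpow_one]
  rw [hscale] at hlo hhi
  have e1 : (Nat.nthRoot 3 (n * 8 ^ k) : ℝ) / 2 ^ k ≤ (n : ℝ) ^ (1 / 3 : ℝ) := by
    rw [div_le_iff₀ hpos]; exact hlo
  have e2 : (n : ℝ) ^ (1 / 3 : ℝ) ≤ ((Nat.nthRoot 3 (n * 8 ^ k) : ℝ) + 1) / 2 ^ k := by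
    rw [le_div_iff₀ hpos]; exact hhi.le
  have e3 : (0 : ℝ) ≤ 1 / 2 ^ k := by positivity
  rw [add_div] at e2
  rw [abs_le]
  constructor <;> linarith

end CodeFP

end Literature.Computability.Complexity
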